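import Literature.Geometry.Lorentzian.CauchyDevelopment
import Literature.Geometry.Lorentzian.KerrData
import Literature.Geometry.Lorentzian.LorentzianDistance
import Literature.Geometry.Lorentzian.CausalFutureProofs
import Literature.Geometry.Lorentzian.CausalCurveNullGeodesic
import Literature.Geometry.Lorentzian.ConvergenceTransport
import HarnessLib

/-!
# Crux `TameCensorship` (stmt-FinalStateConjecture-10047), line `crush-the-swallowed-interior`,
# stub B `stub_exactKerrBookkeeping`: the swallowed region is future closed, the exact part is
# causally convex, and the black hole is mortal inside any exact-Kerr chart (conjuncts B2, B3)

For a Cauchy development `𝒟 = (M, g, τ, ι, ν)` of data on `X` and a subset `K ⊆ X` (for a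
Kerr-shielded datum: the compact core `K = (range φ)ᶜ`), write `swallowed = J⁺(ιK)` and
`E = J⁺(ιX) ∖ J⁺(ιK)` (the *exact part*). This file proves the causal bookkeeping of stub B that
does not depend on the Kerr geometry, and reduces its mortality conjunct (B3) to the finite
timelike diameter of the Kerr black-hole region read through a chart:

* `causalFuture_singleton_subset_swallowed` — **(B2) `swallowed` is future closed**:
  `J⁺(m) ⊆ J⁺(ιK)` for `m ∈ J⁺(ιK)` (`J⁺ ∘ J⁺ = J⁺`, tree `causalFuture_causalFuture_eq`);
* `mem_exactPart_of_mem_causalFuture_of_mem_causalPast`, `curve_mem_exactPart` — **`E` is causally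
  convex**: a point causally between a point of `J⁺(ιX)` and a point outside `J⁺(ιK)` lies in `E`;
  in particular every future causal curve from `E` to `E` stays in `E`;
* `isFutureDirected_mfderiv_of_chart`, `isFutureCausalCurveOn_comp_of_chart`,
  `isFutureTimelikeCurveOn_comp_of_chart`, `arcLength_comp_of_chart` — a map `χ` which on an open set
  `U` is smooth, isometric and time-orientation preserving carries future causal / timelike curves
  inside `U` to future causal / timelike curves of the same length (local forms of
  `ConvergenceTransport.lean`);
* `lorentzDist_le_of_exactKerrChart` — **(B3) from the Kerr diameter bound**: if `χ` is such a chart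
  on an open `E' ⊇ E` into the Kerr chart `Kerr.spacetime M a r₋`, and time separations of that chart
  from points with `r < r₊` are bounded by `C`, then `d_𝒟(p, q) ≤ C` for `p, q ∈ E` with
  `r(χ p) < r₊` (every causal curve from `p` to `q` stays in `E ⊆ E'` and is carried by `χ` to a Kerr
  causal curve of the same length).

References: O'Neill 1983, Ch. 14, pp. 402–409 (causality relations, time separation), Ch. 3,
pp. 90–91 (isometric immersions); Hawking–Ellis 1973, §6.5; O'Neill 1995, §2.5.
-/

set_option linter.dupNamespace false

noncomputable section

open scoped Manifold ContDiff Topology ENNReal NNReal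
open Set Filter Bundle MeasureTheory
open Literature.Geometry.Lorentzian

namespace Summit.FinalStateConjecture.FinalStateConjecture.Theorems.PhotonSphereChannels.TameCensorshipCrush

universe u

/-! ## (B2) and the causal convexity of the exact part -/

section Causal

variable {X : Type u} [TopologicalSpace X] [ChartedSpace (EuclideanSpace ℝ (Fin 3)) X]
  [IsManifold (𝓡 3) ∞ X] [ConnectedSpace X] {D : InitialDataSet (𝓡 3) X}

/-- **(B2) The swallowed region `J⁺(ιK)` is future closed**: `J⁺(m) ⊆ J⁺(ιK)` for every
`m ∈ J⁺(ιK)` (`J⁺(J⁺ S) = J⁺ S` on a manifold without boundary). O'Neill 1983, Ch. 14, p. 402.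
[cite: ONeillSemiRiemannian1983, Ch. 14, p. 402] -/
theorem causalFuture_singleton_subset_swallowed (𝒟 : CauchyDevelopment D) (K : Set X)
    {m : 𝒟.carrier}
    (hm : m ∈ 𝒟.metric.causalFuture 𝒟.timeOrientation (𝒟.embed '' K)) :
    𝒟.metric.causalFuture 𝒟.timeOrientation {m} ⊆
      𝒟.metric.causalFuture 𝒟.timeOrientation (𝒟.embed '' K) := by
  have hn2 : (2 : ℕ∞ω) ≤ ((⊤ : ℕ∞) : WithTop ℕ∞) := WithTop.coe_le_coe.mpr le_top
  intro q hq
  have h : q ∈ 𝒟.metric.causalFuture 𝒟.timeOrientation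
      (𝒟.metric.causalFuture 𝒟.timeOrientation (𝒟.embed '' K)) :=
    LorentzianMetric.causalFuture_mono (singleton_subset_iff.2 hm) hq
  rwa [LorentzianMetric.causalFuture_causalFuture_eq hn2] at h

/-- **The exact part is causally convex**: if `p ∈ J⁺(S)`, `q ∉ J⁺(S')` and `m` lies causally
between them (`m ∈ J⁺(p)`, `q ∈ J⁺(m)`), then `m ∈ J⁺(S) ∖ J⁺(S')` (transitivity of `≤`).
O'Neill 1983, Ch. 14, p. 402. [cite: ONeillSemiRiemannian1983, Ch. 14, p. 402] -/
theorem mem_exactPart_of_mem_causalFuture_of_mem_causalFuture (𝒟 : CauchyDevelopment D)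
    {S S' : Set 𝒟.carrier} {p m q : 𝒟.carrier}
    (hp : p ∈ 𝒟.metric.causalFuture 𝒟.timeOrientation S)
    (hq : q ∉ 𝒟.metric.causalFuture 𝒟.timeOrientation S')
    (hpm : m ∈ 𝒟.metric.causalFuture 𝒟.timeOrientation {p})
    (hmq : q ∈ 𝒟.metric.causalFuture 𝒟.timeOrientation {m}) :
    m ∈ 𝒟.metric.causalFuture 𝒟.timeOrientation S \ 𝒟.metric.causalFuture 𝒟.timeOrientation S' := by
  have hn2 : (2 : ℕ∞ω) ≤ ((⊤ : ℕ∞) : WithTop ℕ∞) := WithTop.coe_le_coe.mpr le_top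
  refine ⟨?_, fun hm ↦ hq ?_⟩
  · have h : m ∈ 𝒟.metric.causalFuture 𝒟.timeOrientation
        (𝒟.metric.causalFuture 𝒟.timeOrientation S) :=
      LorentzianMetric.causalFuture_mono (singleton_subset_iff.2 hp) hpm
    rwa [LorentzianMetric.causalFuture_causalFuture_eq hn2] at h
  · have h : q ∈ 𝒟.metric.causalFuture 𝒟.timeOrientation
        (𝒟.metric.causalFuture 𝒟.timeOrientation S') :=
      LorentzianMetric.causalFuture_mono (singleton_subset_iff.2 hm) hmq
    rwa [LorentzianMetric.causalFuture_causalFuture_eq hn2] at h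

/-- **A future causal curve from `J⁺(S)` to a point outside `J⁺(S')` stays in `J⁺(S) ∖ J⁺(S')`**
(each of its points lies causally between its endpoints). O'Neill 1983, Ch. 14, p. 402.
[cite: ONeillSemiRiemannian1983, Ch. 14, pp. 402–403] -/
theorem curve_mem_exactPart (𝒟 : CauchyDevelopment D) {S S' : Set 𝒟.carrier}
    {γ : ℝ → 𝒟.carrier} {a b : ℝ}
    (hγ : 𝒟.metric.IsFutureCausalCurveOn 𝒟.timeOrientation γ (Icc a b))
    (ha : γ a ∈ 𝒟.metric.causalFuture 𝒟.timeOrientation S)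
    (hb : γ b ∉ 𝒟.metric.causalFuture 𝒟.timeOrientation S') {t : ℝ} (ht : t ∈ Icc a b) :
    γ t ∈ 𝒟.metric.causalFuture 𝒟.timeOrientation S \
      𝒟.metric.causalFuture 𝒟.timeOrientation S' :=
  mem_exactPart_of_mem_causalFuture_of_mem_causalFuture 𝒟 ha hb
    (IsFutureCausalCurveOn.apply_mem_causalFuture 𝒟.timeOrientation ht.1
      (hγ.mono (Icc_subset_Icc_right ht.2)))
    (IsFutureCausalCurveOn.apply_mem_causalFuture 𝒟.timeOrientation ht.2
      (hγ.mono (Icc_subset_Icc_left ht.1)))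

end Causal

/-! ## Transport of causal curves through a local isometric chart -/

section Chart

variable {𝓢 𝓣 : Spacetime.{u} 4} {U : Set 𝓢.carrier} {χ : 𝓢.carrier → 𝓣.carrier}

/-- **A local time-orientation preserving isometry carries future-directed vectors to
future-directed vectors** (and timelike to timelike): pointwise version, at a point `p` where
`g_𝓣(dχ v, dχ w) = g_𝓢(v, w)` and `dχ τ_𝓢` is future. O'Neill 1983, Ch. 5, p. 145 (timecones).
[cite: ONeillSemiRiemannian1983, Ch. 5, p. 145] -/
theorem isFutureDirected_mfderiv_of_chart {p : 𝓢.carrier}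
    (hg : ∀ v w, 𝓣.metric.val (χ p) (mfderiv (𝓡 4) (𝓡 4) χ p v) (mfderiv (𝓡 4) (𝓡 4) χ p w) =
      𝓢.metric.val p v w)
    (hτ : 𝓣.timeOrientation.IsFutureDirected
      (mfderiv (𝓡 4) (𝓡 4) χ p (𝓢.timeOrientation.vectorField p)))
    {v : TangentSpace (𝓡 4) p} (hv : 𝓢.timeOrientation.IsFutureDirected v) :
    𝓣.timeOrientation.IsFutureDirected (mfderiv (𝓡 4) (𝓡 4) χ p v) ∧
      (𝓢.metric.IsTimelike v → 𝓣.metric.IsTimelike (mfderiv (𝓡 4) (𝓡 4) χ p v)) := by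
  -- adapted from `PreservesTimeOrientation.isFutureDirected_mfderiv` (`ConvergenceTransport`)
  have hT : 𝓣.metric.IsTimelike (mfderiv (𝓡 4) (𝓡 4) χ p (𝓢.timeOrientation.vectorField p)) := by
    rw [LorentzianMetric.isTimelike_iff, hg]; exact 𝓢.timeOrientation.isTimelike p
  have hvc : 𝓣.metric.IsCausal (mfderiv (𝓡 4) (𝓡 4) χ p v) := by
    refine ⟨by rw [hg]; exact hv.1.1, fun h0 ↦ hv.1.2 ?_⟩
    apply 𝓢.metric.nondegenerate p v
    intro w
    rw [← hg, h0, map_zero, zero_apply]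
  refine ⟨𝓣.timeOrientation.isFutureDirected_of_val_lt_zero hτ hT hvc ?_, fun hvt ↦ ?_⟩
  · rw [hg]; exact hv.2
  · rw [LorentzianMetric.isTimelike_iff, hg]; exact hvt

/-- **Velocity of the transported curve**: `(χ ∘ γ)' t = dχ (γ' t)` at a parameter where `γ` is
differentiable and `χ` is differentiable at `γ t` (chain rule). [folklore] -/
theorem velocity_comp_of_mdifferentiableAt {γ : ℝ → 𝓢.carrier} {t : ℝ}
    (hχ : MDifferentiableAt (𝓡 4) (𝓡 4) χ (γ t)) (hγ : MDifferentiableAt 𝓘(ℝ, ℝ) (𝓡 4) γ t) :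
    velocity (𝓡 4) (χ ∘ γ) t = mfderiv (𝓡 4) (𝓡 4) χ (γ t) (velocity (𝓡 4) γ t) := by
  unfold velocity
  rw [mfderiv_comp t hχ hγ]
  rfl

/-- **A chart which is smooth, isometric and time-orientation preserving on an open set `U` carries
future causal curves inside `U` to future causal curves** (local form of
`IsFutureCausalCurveOn.comp_mdifferentiable`). O'Neill 1983, Ch. 14, p. 402.
[cite: ONeillSemiRiemannian1983, Ch. 14, p. 402] -/
theorem isFutureCausalCurveOn_comp_of_chart (hU : IsOpen U)
    (hχs : ContMDiffOn (𝓡 4) (𝓡 4) ∞ χ U)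
    (hχ : ∀ p ∈ U, (∀ v w, 𝓣.metric.val (χ p) (mfderiv (𝓡 4) (𝓡 4) χ p v)
        (mfderiv (𝓡 4) (𝓡 4) χ p w) = 𝓢.metric.val p v w) ∧
      𝓣.timeOrientation.IsFutureDirected
        (mfderiv (𝓡 4) (𝓡 4) χ p (𝓢.timeOrientation.vectorField p)))
    {γ : ℝ → 𝓢.carrier} {s : Set ℝ} (hγ : 𝓢.metric.IsFutureCausalCurveOn 𝓢.timeOrientation γ s)
    (hγU : ∀ t ∈ s, γ t ∈ U) :
    𝓣.metric.IsFutureCausalCurveOn 𝓣.timeOrientation (χ ∘ γ) s ∧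
      ∀ t ∈ s, velocity (𝓡 4) (χ ∘ γ) t = mfderiv (𝓡 4) (𝓡 4) χ (γ t) (velocity (𝓡 4) γ t) := by
  have hd : ∀ t ∈ s, MDifferentiableAt (𝓡 4) (𝓡 4) χ (γ t) := fun t ht ↦
    ((hχs _ (hγU t ht)).contMDiffAt (hU.mem_nhds (hγU t ht))).mdifferentiableAt (by simp)
  have hvel : ∀ t ∈ s, velocity (𝓡 4) (χ ∘ γ) t =
      mfderiv (𝓡 4) (𝓡 4) χ (γ t) (velocity (𝓡 4) γ t) := fun t ht ↦
    velocity_comp_of_mdifferentiableAt (hd t ht) (hγ t ht).1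
  refine ⟨fun t ht ↦ ⟨(hd t ht).comp t (hγ t ht).1, ?_⟩, hvel⟩
  rw [hvel t ht]
  exact (isFutureDirected_mfderiv_of_chart (hχ _ (hγU t ht)).1 (hχ _ (hγU t ht)).2 (hγ t ht).2).1

/-- **Timelike version**: such a chart carries future timelike curves inside `U` to future
timelike curves. O'Neill 1983, Ch. 14, p. 402. [cite: ONeillSemiRiemannian1983, Ch. 14, p. 402] -/
theorem isFutureTimelikeCurveOn_comp_of_chart (hU : IsOpen U)
    (hχs : ContMDiffOn (𝓡 4) (𝓡 4) ∞ χ U)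
    (hχ : ∀ p ∈ U, (∀ v w, 𝓣.metric.val (χ p) (mfderiv (𝓡 4) (𝓡 4) χ p v)
        (mfderiv (𝓡 4) (𝓡 4) χ p w) = 𝓢.metric.val p v w) ∧
      𝓣.timeOrientation.IsFutureDirected
        (mfderiv (𝓡 4) (𝓡 4) χ p (𝓢.timeOrientation.vectorField p)))
    {γ : ℝ → 𝓢.carrier} {s : Set ℝ} (hγ : 𝓢.metric.IsFutureTimelikeCurveOn 𝓢.timeOrientation γ s)
    (hγU : ∀ t ∈ s, γ t ∈ U) :
    𝓣.metric.IsFutureTimelikeCurveOn 𝓣.timeOrientation (χ ∘ γ) s := by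
  obtain ⟨hc, hvel⟩ := isFutureCausalCurveOn_comp_of_chart hU hχs hχ hγ.isFutureCausalCurveOn hγU
  intro t ht
  refine ⟨(hc t ht).1, ?_, (hc t ht).2⟩
  rw [hvel t ht]
  exact (isFutureDirected_mfderiv_of_chart (hχ _ (hγU t ht)).1 (hχ _ (hγU t ht)).2
    (hγ t ht).2.2).2 (hγ t ht).2.1

/-- **Such a chart preserves arc length**: `L_𝓣(χ ∘ γ|[a, b]) = L_𝓢(γ|[a, b])` for a future causal
curve `γ` on `[a, b]` inside `U` (the speeds agree pointwise). O'Neill 1983, Ch. 5, Def. 5.11;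
Ch. 3, p. 58. [cite: ONeillSemiRiemannian1983, Ch. 5, Def. 5.11 (pp. 131–132)] -/
theorem arcLength_comp_of_chart (hU : IsOpen U)
    (hχs : ContMDiffOn (𝓡 4) (𝓡 4) ∞ χ U)
    (hχ : ∀ p ∈ U, (∀ v w, 𝓣.metric.val (χ p) (mfderiv (𝓡 4) (𝓡 4) χ p v)
        (mfderiv (𝓡 4) (𝓡 4) χ p w) = 𝓢.metric.val p v w) ∧
      𝓣.timeOrientation.IsFutureDirected
        (mfderiv (𝓡 4) (𝓡 4) χ p (𝓢.timeOrientation.vectorField p)))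
    {γ : ℝ → 𝓢.carrier} {a b : ℝ}
    (hγ : 𝓢.metric.IsFutureCausalCurveOn 𝓢.timeOrientation γ (Icc a b))
    (hγU : ∀ t ∈ Icc a b, γ t ∈ U) :
    𝓣.metric.toPseudoRiemannianMetric.arcLength (χ ∘ γ) a b =
      𝓢.metric.toPseudoRiemannianMetric.arcLength γ a b := by
  obtain ⟨-, hvel⟩ := isFutureCausalCurveOn_comp_of_chart hU hχs hχ hγ hγU
  refine setLIntegral_congr_fun measurableSet_Icc (fun t ht ↦ ?_)
  rw [PseudoRiemannianMetric.speed_def, PseudoRiemannianMetric.speed_def, hvel t ht]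
  have h1 : 𝓣.metric.val ((χ ∘ γ) t) (mfderiv (𝓡 4) (𝓡 4) χ (γ t) (velocity (𝓡 4) γ t))
      (mfderiv (𝓡 4) (𝓡 4) χ (γ t) (velocity (𝓡 4) γ t)) =
      𝓢.metric.val (γ t) (velocity (𝓡 4) γ t) (velocity (𝓡 4) γ t) := (hχ _ (hγU t ht)).1 _ _
  change ENNReal.ofReal (Real.sqrt |𝓣.metric.val ((χ ∘ γ) t)
    (mfderiv (𝓡 4) (𝓡 4) χ (γ t) (velocity (𝓡 4) γ t))
    (mfderiv (𝓡 4) (𝓡 4) χ (γ t) (velocity (𝓡 4) γ t))|) = _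
  rw [h1]

end Chart

/-! ## (B3) Mortality of the black hole inside an exact-Kerr chart -/

section Mortal

/-- **(B3) The black hole is mortal inside the exact part, from the Kerr diameter bound.** Let `𝒟`
be a Cauchy development, `K ⊆ X`, `E = J⁺(ιX) ∖ J⁺(ιK)`, and `χ : M → Kerr.region a r₋` a map which
on an open `E' ⊇ E` is smooth, isometric into `Kerr.spacetime M a r₋` and time-orientation
preserving. If time separations of the Kerr chart from points with `r < r₊` are bounded by `C`
(the finite timelike diameter of Boyer–Lindquist block II, O'Neill 1995, §2.5), then
`d_𝒟(p, q) ≤ C` for all `p, q ∈ E` with `r(χ p) < r₊`: every future causal curve from `p` to `q`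
stays in `E` (`curve_mem_exactPart`), so `χ` carries it to a future causal curve of the Kerr chart of
the same length (`arcLength_comp_of_chart`), bounded by `d_Kerr(χ p, χ q) ≤ C`.
[cite: ONeillSemiRiemannian1983, Ch. 14, Def. 14.15 (p. 409)] [cite: ONeill1995, Ch. 2, §2.5] -/
theorem lorentzDist_le_of_exactKerrChart {X : Type} [TopologicalSpace X] [ChartedSpace E3 X]
    [IsManifold (𝓡 3) ((⊤ : ℕ∞) : WithTop ℕ∞) X] [ConnectedSpace X] {D : InitialDataSet (𝓡 3) X}
    [Kerr.Facts] (𝒟 : CauchyDevelopment D) (K : Set X)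
    {M a : ℝ} (hM : 0 ≤ M) {E' : Set 𝒟.carrier}
    {χ : 𝒟.carrier → Kerr.region a (Kerr.rMinus M a)}
    (hEE' : 𝒟.metric.causalFuture 𝒟.timeOrientation (Set.range 𝒟.embed) \
        𝒟.metric.causalFuture 𝒟.timeOrientation (𝒟.embed '' K) ⊆ E')
    (hE'o : IsOpen E') (hχs : ContMDiffOn (𝓡 4) (𝓡 4) ((⊤ : ℕ∞) : WithTop ℕ∞) χ E')
    (hχ : ∀ p ∈ E', (∀ v w, Kerr.bilin M a (χ p : E4) (mfderiv (𝓡 4) (𝓡 4) χ p v)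
        (mfderiv (𝓡 4) (𝓡 4) χ p w) = 𝒟.metric.val p v w) ∧
      (Kerr.spacetime M a (Kerr.rMinus M a) hM).timeOrientation.IsFutureDirected
        (mfderiv (𝓡 4) (𝓡 4) χ p (𝒟.timeOrientation.vectorField p)))
    {C : ℝ≥0}
    (hC : ∀ x y : Kerr.region a (Kerr.rMinus M a), Kerr.radius a (x : E4) < Kerr.rPlus M a →
      (Kerr.spacetime M a (Kerr.rMinus M a) hM).lorentzDist x y ≤ (C : ℝ≥0∞))
    {p : 𝒟.carrier}
    (hp : p ∈ 𝒟.metric.causalFuture 𝒟.timeOrientation (Set.range 𝒟.embed) \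
      𝒟.metric.causalFuture 𝒟.timeOrientation (𝒟.embed '' K))
    (hpr : Kerr.radius a (χ p : E4) < Kerr.rPlus M a) {q : 𝒟.carrier}
    (hq : q ∈ 𝒟.metric.causalFuture 𝒟.timeOrientation (Set.range 𝒟.embed) \
      𝒟.metric.causalFuture 𝒟.timeOrientation (𝒟.embed '' K)) :
    𝒟.toSpacetime.lorentzDist p q ≤ (C : ℝ≥0∞) := by
  rw [Spacetime.lorentzDist_eq, LorentzianMetric.lorentzDist_le_iff]
  intro γ a' b' hab hγ hγa hγb
  -- the curve stays in `E ⊆ E'`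
  have hγE : ∀ t ∈ Icc a' b', γ t ∈ E' := fun t ht ↦
    hEE' (curve_mem_exactPart 𝒟 hγ (hγa ▸ hp.1) (hγb ▸ hq.2) ht)
  -- transport to the Kerr chart
  have hχ' : ∀ p ∈ E', (∀ v w, (Kerr.spacetime M a (Kerr.rMinus M a) hM).metric.val (χ p)
      (mfderiv (𝓡 4) (𝓡 4) χ p v) (mfderiv (𝓡 4) (𝓡 4) χ p w) = 𝒟.metric.val p v w) ∧
      (Kerr.spacetime M a (Kerr.rMinus M a) hM).timeOrientation.IsFutureDirected
        (mfderiv (𝓡 4) (𝓡 4) χ p (𝒟.timeOrientation.vectorField p)) := hχ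
  have hc := (isFutureCausalCurveOn_comp_of_chart (𝓢 := 𝒟.toSpacetime)
    (𝓣 := Kerr.spacetime M a (Kerr.rMinus M a) hM) hE'o hχs hχ' hγ hγE).1
  have hL := arcLength_comp_of_chart (𝓢 := 𝒟.toSpacetime)
    (𝓣 := Kerr.spacetime M a (Kerr.rMinus M a) hM) hE'o hχs hχ' hγ hγE
  calc 𝒟.metric.toPseudoRiemannianMetric.arcLength γ a' b'
      = (Kerr.spacetime M a (Kerr.rMinus M a) hM).metric.toPseudoRiemannianMetric.arcLength
          (χ ∘ γ) a' b' := hL.symm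
    _ ≤ (Kerr.spacetime M a (Kerr.rMinus M a) hM).lorentzDist (χ p) (χ q) :=
        LorentzianMetric.arcLength_le_lorentzDist hab hc (by simp [hγa]) (by simp [hγb])
    _ ≤ (C : ℝ≥0∞) := hC (χ p) (χ q) hpr

end Mortal

end Summit.FinalStateConjecture.FinalStateConjecture.Theorems.PhotonSphereChannels.TameCensorshipCrush

end
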